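import Summits.QuantumFields.QCD.Theses.TransparentRPWall
import Literature.MathematicalPhysics.QuantumFieldTheory.TiltedTorusLatticeSchwinger
import Literature.MathematicalPhysics.QuantumFieldTheory.QCDAsymptoticScalingCouplingDivergence
import Summits.QuantumFields.YangMills.Theorems.PencilRigidityDiagonalMirrorRPRStubRpClosureDefs
import Summits.QuantumFields.YangMills.Theorems.PencilRigidityDiagonalMirrorRPRStubRpClosureSupport
import Summits.QuantumFields.YangMills.Theorems.PencilRigidityDiagonalMirrorRPRStubRpClosureDensity
import HarnessLib.Audit

/-!
# `WallTransparency` — birth skeleton (piece X_T of the BC2 redirect of `TransparentRPWall.WallDiagonalRP`, stmt-QuantumFields-10466)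

Crux-strategist planner-cstrat-stmt-QuantumFields-10466-r1-0, 2026-08-17.  Piece X_T = THE BET of the route at this node:
along any scheme/limit pair carrying AF, the physical branch, honest convergence to `S`, the OS package of `S` and the gaps, the wall-cover functional and the honest `qcdLatticeSchwinger` have the same
limit behaviour on compactly supported real tensors with pairwise disjoint supports (`n ≠ 0`).

Stubs (the ONLY `sorry`s) — the two physically distinct halves of transparency:
* `stub_coverInsensitivityQCD` — **VOLUME-SHAPE insensitivity (XL, open): cubic torus `ℤ⁴/(2L_k+1)ℤ⁴` vs its FILS 45° cover with
  HONEST Wilson quarks.**  The QCD twin of the YangMills stub `T⁺` of crux `DiagonalMirrorRPR` (stmt-10604; `CoverInsensitivity`,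
  nineteen leads: existence-level along an arbitrary gapped scheme, free for any genuine construction on boundaryless volumes of
  another shape); mechanism: the uniform lattice gap (`HasLatticeMassGap`) ⇒ exponential insensitivity of compactly supported
  expectations to the far boundary identification (`a_k L_k → ∞`), Lüscher 1977 transfer matrix / Osterwalder–Seiler §4.
* `stub_wallInsensitivity` — **THE WALL IS TRANSPARENT (XL, open — the card's K2): honest cover functional vs wall-modified cover
  functional.**  The modification is a codimension-1 Symanzik defect supported on the two wall layers: `D_w − D = ` (re-spun minus
  Wilson hops on wall-touching links) = `a·ψ̄(γ_n − γ_μ-structure)∂ψ|_W` + irrelevant; its only non-irrelevant induced coupling is the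
  wall mass `ψ̄ψ|_W`, absent at tree level and `O(g₀²(a))` radiatively (Symanzik 1981/83, Lüscher et al. 1992 boundary counting,
  Sint 2011 for the rotated-projector cousin), so compactly supported correlators at physical distance from the walls converge to
  the same limit (untuned rate `(log 1/a)^{−γ₀/2β₀}`); why it might fail: a wall-critical (layer-Aoki) or bound-state-carrying wall
  is opaque — the recorded why-might-fail of the parent crux, now isolated in ONE stub.
* `WallTransparency_of` — PROVED: `(wall − honest) = (wall − cover) + (cover − honest)`.

-/

set_option autoImplicit false

noncomputable section

namespace Summit.QuantumFields.QCD.Cruxes.WallDiagonalRP.WallTransparencyBirth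

open scoped BigOperators Topology Classical ComplexConjugate SchwartzMap
open Filter Set Function MeasureTheory
open Literature.MathematicalPhysics.QuantumLattice Literature.MathematicalPhysics.AQFT
  Literature.MathematicalPhysics.QuantumFieldTheory Literature.Probability.LatticeModels

/-! ## §0 Vocabulary (verbatim the inline `let`s of the route items, given names) -/

/-- Euclidean `ℝ⁴`, time = coordinate `0`. -/
abbrev E4 : Type := EuclideanSpace ℝ (Fin 4)

/-- **The wall-modified lattice QCD `n`-point functional on the FILS 45° cover** `T̃_{N_k}`, `N_k = sch.side k`
(chart `(u,w,y,z) = (x₀−x₁, x₁, x₂, x₃)`, walls `u = 0` and `u = N_k`): Wilson's `SU(3)` plaquette weight on the cover,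
`N_f` Wilson quarks (`r = 1`, bare masses `m_f(k)`) whose hops in directions `0, 1` touching a wall are re-spun
`γ₀ ↦ +γ_n`, `γ₁ ↦ −γ_n`, `γ_n = (γ₀ − γ₁)/√2`, Berezin-integrated; the same smeared, rescaled, renormalised species fields as
`qcdLatticeSchwinger` (box `[-L_k, L_k]⁴ ⊂ ℤ⁴`, `z_s(k) a_k⁴ ∑ f(a_k x)(O_s(x) − shift_s(k))`, glue read through the
`Λ̃`-periodic lift, mesons at the cover site); normalised by its own partition function; `1` in degree `0`. VERBATIM the
`Wfun` of the route items `CoverWallRP` / `WallTransparency`. -/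
def wallFun : (Nf : ℕ) → QCDScheme Nf → ℕ → (n : ℕ) → (Fin n → QCDField Nf) → (Fin n → 𝓢(E4, ℝ)) → ℂ :=
  let E := EuclideanSpace ℝ (Fin 4);
  let SU3 := ↥(Matrix.specialUnitaryGroup (Fin 3) ℂ);
  let γn : Matrix (Fin 4) (Fin 4) ℂ := (((Real.sqrt 2)⁻¹ : ℝ) : ℂ) • (euclideanGamma 0 - euclideanGamma 1);
  fun Nf sch k n σ f =>
      (let T := TiltedTorus.Site (sch.side k);
       let C := TiltedTorus.Config (sch.side k) SU3;
       let ρ := fundamentalRep (Fin 3);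
       let V := Fin Nf × (T × Fin 3 × Fin 4);
       let I := Fin (Fintype.card V);
       let e : V ≃ I := Fintype.equivFin V;
       let A := GrassmannAlgebra ℂ (I ⊕ₗ I);
       let wall : T → Prop := fun x => x.1 = 0 ∨ x.1 = ((sch.side k : ℕ) : ZMod (2 * sch.side k));
       let Γ : Fin 4 → T → T → Matrix (Fin 4) (Fin 4) ℂ :=
         fun μ x y => if (μ = 0 ∨ μ = 1) ∧ (wall x ∨ wall y) then (if μ = 0 then γn else -γn) else euclideanGamma μ;
       let D : C → Matrix I I ℂ := fun U => Matrix.reindex e e (Matrix.of fun v w =>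
         if v.1 = w.1 then
           ((if v.2 = w.2 then ((sch.mq v.1 k + 4 : ℝ) : ℂ) else 0) -
             (1 / 2 : ℂ) * ∑ μ : Fin 4,
               ((if w.2.1 = v.2.1 + TiltedTorus.step μ then
                   (1 - Γ μ v.2.1 w.2.1) v.2.2.2 w.2.2.2 * ρ (U (v.2.1, μ)) v.2.2.1 w.2.2.1 else 0) +
                (if v.2.1 = w.2.1 + TiltedTorus.step μ then
                   (1 + Γ μ v.2.1 w.2.1) v.2.2.2 w.2.2.2 * ρ ((U (w.2.1, μ))⁻¹) v.2.2.1 w.2.2.1 else 0)))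
         else 0);
       let boltz : C → A := fun U => grassmannExp (quadratic ℂ (-D U));
       let P : Fin Nf → Fin Nf → T → A := fun fl g x =>
         ∑ a : Fin 3, ∑ α : Fin 4, ∑ β : Fin 4,
           (Complex.I * gammaFive α β) • (psiBar ℂ (e (fl, (x, a, α))) * psi ℂ (e (g, (x, a, β))));
       let ins : C → QCDField Nf → Site 4 → A := fun U s x =>
         let y := TiltedTorus.proj (sch.side k) x;
         match s with
         | .glue => algebraMap ℂ A ((actionDensity ρ (configShift (-x) (TiltedTorus.lift (sch.side k) U)) : ℝ) : ℂ)
         | .pseudoRe fl g => (1 / 2 : ℂ) • (P fl g y + P g fl y)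
         | .pseudoIm fl g => (-Complex.I / 2) • (P fl g y - P g fl y);
       let sm : C → QCDField Nf → SchwartzMap E ℝ → A := fun U s h =>
         ∑ x ∈ box 4 (sch.L k), ((sch.z s k * sch.a k ^ 4 * h (sch.a k • siteToE x) : ℝ) : ℂ) •
           (ins U s x - algebraMap ℂ A ((sch.shift s k : ℝ) : ℂ));
       let wt : C → ℂ := fun U => ((TiltedTorus.weight ρ (sch.β k) U : ℝ) : ℂ);
       let ber := GrassmannAlgebra.berezin ℂ (I ⊕ₗ I);
       let ν := (TiltedTorus.haar (sch.side k) : Measure C);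
       if n = 0 then (1 : ℂ) else
         (∫ U, ber ((List.ofFn fun i => sm U (σ i) (f i)).prod * boltz U) * wt U ∂ν) /
           (∫ U, ber (boltz U) * wt U ∂ν))

/-- **The HONEST lattice QCD functional on the 45° cover** (no wall modification: `Γ_μ ≡ γ_μ`) — the same text with the wall
predicate `False`; the cover twin of `qcdLatticeSchwinger` (which lives on the cubic torus `ℤ⁴/(2L_k+1)ℤ⁴`). -/
def coverFun : (Nf : ℕ) → QCDScheme Nf → ℕ → (n : ℕ) → (Fin n → QCDField Nf) → (Fin n → 𝓢(E4, ℝ)) → ℂ :=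
  let E := EuclideanSpace ℝ (Fin 4);
  let SU3 := ↥(Matrix.specialUnitaryGroup (Fin 3) ℂ);
  let γn : Matrix (Fin 4) (Fin 4) ℂ := (((Real.sqrt 2)⁻¹ : ℝ) : ℂ) • (euclideanGamma 0 - euclideanGamma 1);
  fun Nf sch k n σ f =>
      (let T := TiltedTorus.Site (sch.side k);
       let C := TiltedTorus.Config (sch.side k) SU3;
       let ρ := fundamentalRep (Fin 3);
       let V := Fin Nf × (T × Fin 3 × Fin 4);
       let I := Fin (Fintype.card V);
       let e : V ≃ I := Fintype.equivFin V;
       let A := GrassmannAlgebra ℂ (I ⊕ₗ I);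
       let wall : T → Prop := fun x => x.1 = 0 ∨ x.1 = ((sch.side k : ℕ) : ZMod (2 * sch.side k));
       let Γ : Fin 4 → T → T → Matrix (Fin 4) (Fin 4) ℂ :=
         fun μ x y => if (μ = 0 ∨ μ = 1) ∧ (wall x ∨ wall y) then (if μ = 0 then γn else -γn) else euclideanGamma μ;
       let D : C → Matrix I I ℂ := fun U => Matrix.reindex e e (Matrix.of fun v w =>
         if v.1 = w.1 then
           ((if v.2 = w.2 then ((sch.mq v.1 k + 4 : ℝ) : ℂ) else 0) -
             (1 / 2 : ℂ) * ∑ μ : Fin 4,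
               ((if w.2.1 = v.2.1 + TiltedTorus.step μ then
                   (1 - Γ μ v.2.1 w.2.1) v.2.2.2 w.2.2.2 * ρ (U (v.2.1, μ)) v.2.2.1 w.2.2.1 else 0) +
                (if v.2.1 = w.2.1 + TiltedTorus.step μ then
                   (1 + Γ μ v.2.1 w.2.1) v.2.2.2 w.2.2.2 * ρ ((U (w.2.1, μ))⁻¹) v.2.2.1 w.2.2.1 else 0)))
         else 0);
       let boltz : C → A := fun U => grassmannExp (quadratic ℂ (-D U));
       let P : Fin Nf → Fin Nf → T → A := fun fl g x =>
         ∑ a : Fin 3, ∑ α : Fin 4, ∑ β : Fin 4,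
           (Complex.I * gammaFive α β) • (psiBar ℂ (e (fl, (x, a, α))) * psi ℂ (e (g, (x, a, β))));
       let ins : C → QCDField Nf → Site 4 → A := fun U s x =>
         let y := TiltedTorus.proj (sch.side k) x;
         match s with
         | .glue => algebraMap ℂ A ((actionDensity ρ (configShift (-x) (TiltedTorus.lift (sch.side k) U)) : ℝ) : ℂ)
         | .pseudoRe fl g => (1 / 2 : ℂ) • (P fl g y + P g fl y)
         | .pseudoIm fl g => (-Complex.I / 2) • (P fl g y - P g fl y);
       let sm : C → QCDField Nf → SchwartzMap E ℝ → A := fun U s h =>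
         ∑ x ∈ box 4 (sch.L k), ((sch.z s k * sch.a k ^ 4 * h (sch.a k • siteToE x) : ℝ) : ℂ) •
           (ins U s x - algebraMap ℂ A ((sch.shift s k : ℝ) : ℂ));
       let wt : C → ℂ := fun U => ((TiltedTorus.weight ρ (sch.β k) U : ℝ) : ℂ);
       let ber := GrassmannAlgebra.berezin ℂ (I ⊕ₗ I);
       let ν := (TiltedTorus.haar (sch.side k) : Measure C);
       if n = 0 then (1 : ℂ) else
         (∫ U, ber ((List.ofFn fun i => sm U (σ i) (f i)).prod * boltz U) * wt U ∂ν) /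
           (∫ U, ber (boltz U) * wt U ∂ν))

/-- The coordinate swap `x₀ ↔ x₁` on real test functions, `h ↦ h ∘ swap` (VERBATIM the `swapT` of the items). -/
def swapTest (h : 𝓢(E4, ℝ)) : 𝓢(E4, ℝ) :=
  SchwartzMap.compCLMOfContinuousLinearEquiv ℝ
    (LinearIsometryEquiv.piLpCongrLeft 2 ℝ ℝ (Equiv.swap (0 : Fin 4) 1)).toContinuousLinearEquiv h

/-- **Swap Gram form** of a one-step real-tensor functional `Λ₁` on a finite family: term `(i, j)` pairs the string `i`
REVERSED, REFLECTED (`swapTest`) and with reversed labels against the string `j` — the lattice shadow of OS's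
`𝔖(Θfᵢ* ⊗ fⱼ)` for real tensors, complex coefficients `cᵢ`. -/
def gram {ι : Type} (Λ₁ : (n : ℕ) → (Fin n → ι) → (Fin n → 𝓢(E4, ℝ)) → ℂ) (N : ℕ) (c : Fin N → ℂ) (deg : Fin N → ℕ)
    (lab : (j : Fin N) → Fin (deg j) → ι) (f : (j : Fin N) → Fin (deg j) → 𝓢(E4, ℝ)) : ℂ :=
  ∑ i, ∑ j, starRingEnd ℂ (c i) * c j *
    Λ₁ (deg i + deg j) (Fin.append (lab i ∘ Fin.rev) (lab j)) (Fin.append (fun l => swapTest (f i (Fin.rev l))) (f j))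

/-- **The hypothesis package of `WallTransparency`** (the clauses of the route's `W` it keeps: the OS package of `S`, the scheme
triple AF / physical branch / honest convergence to `S`, and the two gaps; translations and signed permutations of `S` are dropped —
honest limits have them anyway). -/
def TPkg (Nf : ℕ) (sch : QCDScheme Nf) (S : LabelledSchwingerFamily (QCDField Nf) E4) : Prop :=
  let E := EuclideanSpace ℝ (Fin 4);
  (S.IsNormalized ∧ S.IsHermitian ∧ S.HasLinearGrowth ∧ S.IsReflectionPositive ∧ S.IsSymmetric ∧ S.HasClusterProperty) ∧
    (sch.HasAsymptoticScaling ∧ (∀ fl : Fin Nf, ∀ᶠ k in Filter.atTop, -1 < sch.mq fl k) ∧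
      (∀ (n : ℕ), n ≠ 0 → ∀ (σ : Fin n → QCDField Nf) (f : Fin n → SchwartzMap E ℝ) (F : SchwartzMap (Fin n → E) ℂ),
        IsTensorOf F (fun i => ofRealTest (f i)) → IsOffDiagonal F →
          Filter.Tendsto (fun k : ℕ => qcdLatticeSchwinger sch k n σ f) Filter.atTop (nhds (S n σ F)))) ∧
    (∃ Δ : ℝ, 0 < Δ ∧ S.HasMassGap Δ ∧ sch.HasLatticeMassGap Δ)

/-- The package `W Nf sch S` of the route (VERBATIM): E0, E0', E2, E3, E4, translations, proper signed permutations on `⁰𝒮`;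
two-loop AF, physical branch, honest convergence; continuum + uniform lattice gap. -/
def WPkg (Nf : ℕ) (sch : QCDScheme Nf) (S : LabelledSchwingerFamily (QCDField Nf) E4) : Prop :=
  let E := EuclideanSpace ℝ (Fin 4);
  ((S.IsNormalized ∧ S.IsHermitian ∧ S.HasLinearGrowth ∧ S.IsReflectionPositive ∧ S.IsSymmetric ∧ S.HasClusterProperty ∧
      (∀ (n : ℕ) (k : Fin n → QCDField Nf) (a : E) (F : SchwartzMap (Fin n → E) ℂ), IsOffDiagonal F → S n k (translateMulti a F) = S n k F) ∧
      (∀ (n : ℕ) (k : Fin n → QCDField Nf) (R : E ≃ₗᵢ[ℝ] E), LinearMap.det (R.toLinearEquiv : E →ₗ[ℝ] E) = 1 →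
        (∀ i : Fin 4, ∃ j : Fin 4, R (EuclideanSpace.single i 1) = EuclideanSpace.single j 1 ∨ R (EuclideanSpace.single i 1) = -EuclideanSpace.single j 1) →
          ∀ F : SchwartzMap (Fin n → E) ℂ, IsOffDiagonal F → S n k (linActMulti R F) = S n k F)) ∧
    (sch.HasAsymptoticScaling ∧ (∀ fl : Fin Nf, ∀ᶠ k in Filter.atTop, -1 < sch.mq fl k) ∧
      (∀ (n : ℕ), n ≠ 0 → ∀ (σ : Fin n → QCDField Nf) (f : Fin n → SchwartzMap E ℝ) (F : SchwartzMap (Fin n → E) ℂ),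
        IsTensorOf F (fun i => ofRealTest (f i)) → IsOffDiagonal F →
          Filter.Tendsto (fun k : ℕ => qcdLatticeSchwinger sch k n σ f) Filter.atTop (nhds (S n σ F)))) ∧
    (∃ Δ : ℝ, 0 < Δ ∧ S.HasMassGap Δ ∧ sch.HasLatticeMassGap Δ))

/-! ## §1 The registered stubs -/

/-- **VOLUME-SHAPE insensitivity (XL, open).** Honest lattice QCD on the cubic torus vs on its FILS 45° cover: the difference of the
species `n`-point functions tends to `0` on compactly supported real tensors with pairwise disjoint supports. -/
theorem stub_coverInsensitivityQCD :
    ∀ (Nf : ℕ) (sch : QCDScheme Nf) (S : LabelledSchwingerFamily (QCDField Nf) E4), TPkg Nf sch S →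
      ∀ (n : ℕ), n ≠ 0 → ∀ (σ : Fin n → QCDField Nf) (f : Fin n → 𝓢(E4, ℝ)),
        (∀ i, HasCompactSupport (f i : E4 → ℝ)) →
          (∀ i j, i ≠ j → Disjoint (tsupport (f i : E4 → ℝ)) (tsupport (f j : E4 → ℝ))) →
            Tendsto (fun k : ℕ => coverFun Nf sch k n σ f - qcdLatticeSchwinger sch k n σ f) atTop (𝓝 0) := by
  sorry

/-- **THE WALL IS TRANSPARENT (XL, open — the bet).** On the cover, the wall-modified and the honest functional have the same limit
behaviour on compactly supported real tensors with pairwise disjoint supports. -/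
theorem stub_wallInsensitivity :
    ∀ (Nf : ℕ) (sch : QCDScheme Nf) (S : LabelledSchwingerFamily (QCDField Nf) E4), TPkg Nf sch S →
      ∀ (n : ℕ), n ≠ 0 → ∀ (σ : Fin n → QCDField Nf) (f : Fin n → 𝓢(E4, ℝ)),
        (∀ i, HasCompactSupport (f i : E4 → ℝ)) →
          (∀ i j, i ≠ j → Disjoint (tsupport (f i : E4 → ℝ)) (tsupport (f j : E4 → ℝ))) →
            Tendsto (fun k : ℕ => wallFun Nf sch k n σ f - coverFun Nf sch k n σ f) atTop (𝓝 0) := by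
  sorry

/-! ## §2 The piece, VERBATIM the route item, and the PROVED composition -/

/-- VERBATIM the statement filed as route item `TransparentRPWall.WallTransparency`. -/
def WallTransparencyStmt : Prop :=
  open Literature.MathematicalPhysics.QuantumLattice Literature.MathematicalPhysics.AQFT Literature.MathematicalPhysics.QuantumFieldTheory Literature.Probability.LatticeModels in
  let E := EuclideanSpace ℝ (Fin 4);
  let SU3 := ↥(Matrix.specialUnitaryGroup (Fin 3) ℂ);
  let γn : Matrix (Fin 4) (Fin 4) ℂ := (((Real.sqrt 2)⁻¹ : ℝ) : ℂ) • (euclideanGamma 0 - euclideanGamma 1);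
  let Wfun : (Nf : ℕ) → QCDScheme Nf → ℕ → (n : ℕ) → (Fin n → QCDField Nf) → (Fin n → SchwartzMap E ℝ) → ℂ :=
    fun Nf sch k n σ f =>
      (let T := TiltedTorus.Site (sch.side k);
       let C := TiltedTorus.Config (sch.side k) SU3;
       let ρ := fundamentalRep (Fin 3);
       let V := Fin Nf × (T × Fin 3 × Fin 4);
       let I := Fin (Fintype.card V);
       let e : V ≃ I := Fintype.equivFin V;
       let A := GrassmannAlgebra ℂ (I ⊕ₗ I);
       let wall : T → Prop := fun x => x.1 = 0 ∨ x.1 = ((sch.side k : ℕ) : ZMod (2 * sch.side k));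
       let Γ : Fin 4 → T → T → Matrix (Fin 4) (Fin 4) ℂ :=
         fun μ x y => if (μ = 0 ∨ μ = 1) ∧ (wall x ∨ wall y) then (if μ = 0 then γn else -γn) else euclideanGamma μ;
       let D : C → Matrix I I ℂ := fun U => Matrix.reindex e e (Matrix.of fun v w =>
         if v.1 = w.1 then
           ((if v.2 = w.2 then ((sch.mq v.1 k + 4 : ℝ) : ℂ) else 0) -
             (1 / 2 : ℂ) * ∑ μ : Fin 4,
               ((if w.2.1 = v.2.1 + TiltedTorus.step μ then
                   (1 - Γ μ v.2.1 w.2.1) v.2.2.2 w.2.2.2 * ρ (U (v.2.1, μ)) v.2.2.1 w.2.2.1 else 0) +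
                (if v.2.1 = w.2.1 + TiltedTorus.step μ then
                   (1 + Γ μ v.2.1 w.2.1) v.2.2.2 w.2.2.2 * ρ ((U (w.2.1, μ))⁻¹) v.2.2.1 w.2.2.1 else 0)))
         else 0);
       let boltz : C → A := fun U => grassmannExp (quadratic ℂ (-D U));
       let P : Fin Nf → Fin Nf → T → A := fun fl g x =>
         ∑ a : Fin 3, ∑ α : Fin 4, ∑ β : Fin 4,
           (Complex.I * gammaFive α β) • (psiBar ℂ (e (fl, (x, a, α))) * psi ℂ (e (g, (x, a, β))));
       let ins : C → QCDField Nf → Site 4 → A := fun U s x =>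
         let y := TiltedTorus.proj (sch.side k) x;
         match s with
         | .glue => algebraMap ℂ A ((actionDensity ρ (configShift (-x) (TiltedTorus.lift (sch.side k) U)) : ℝ) : ℂ)
         | .pseudoRe fl g => (1 / 2 : ℂ) • (P fl g y + P g fl y)
         | .pseudoIm fl g => (-Complex.I / 2) • (P fl g y - P g fl y);
       let sm : C → QCDField Nf → SchwartzMap E ℝ → A := fun U s h =>
         ∑ x ∈ box 4 (sch.L k), ((sch.z s k * sch.a k ^ 4 * h (sch.a k • siteToE x) : ℝ) : ℂ) •
           (ins U s x - algebraMap ℂ A ((sch.shift s k : ℝ) : ℂ));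
       let wt : C → ℂ := fun U => ((TiltedTorus.weight ρ (sch.β k) U : ℝ) : ℂ);
       let ber := GrassmannAlgebra.berezin ℂ (I ⊕ₗ I);
       let ν := (TiltedTorus.haar (sch.side k) : Measure C);
       if n = 0 then (1 : ℂ) else
         (∫ U, ber ((List.ofFn fun i => sm U (σ i) (f i)).prod * boltz U) * wt U ∂ν) /
           (∫ U, ber (boltz U) * wt U ∂ν));
  ∀ (Nf : ℕ) (sch : QCDScheme Nf) (S : LabelledSchwingerFamily (QCDField Nf) E),
    (S.IsNormalized ∧ S.IsHermitian ∧ S.HasLinearGrowth ∧ S.IsReflectionPositive ∧ S.IsSymmetric ∧ S.HasClusterProperty) →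
    (sch.HasAsymptoticScaling ∧ (∀ fl : Fin Nf, ∀ᶠ k in Filter.atTop, -1 < sch.mq fl k) ∧
      (∀ (n : ℕ), n ≠ 0 → ∀ (σ : Fin n → QCDField Nf) (f : Fin n → SchwartzMap E ℝ) (F : SchwartzMap (Fin n → E) ℂ),
        IsTensorOf F (fun i => ofRealTest (f i)) → IsOffDiagonal F →
          Filter.Tendsto (fun k : ℕ => qcdLatticeSchwinger sch k n σ f) Filter.atTop (nhds (S n σ F)))) →
    (∃ Δ : ℝ, 0 < Δ ∧ S.HasMassGap Δ ∧ sch.HasLatticeMassGap Δ) →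
    ∃ Λ : (ℕ → (n : ℕ) → (Fin n → QCDField Nf) → (Fin n → SchwartzMap E ℝ) → ℂ), Λ = (fun k n σ f => Wfun Nf sch k n σ f) ∧
      (∀ (k : ℕ) (σ : Fin 0 → QCDField Nf) (f : Fin 0 → SchwartzMap E ℝ), Λ k 0 σ f = 1) ∧
      (∀ (n : ℕ), n ≠ 0 → ∀ (σ : Fin n → QCDField Nf) (f : Fin n → SchwartzMap E ℝ), (∀ i, HasCompactSupport (f i : E → ℝ)) →
        (∀ i j, i ≠ j → Disjoint (tsupport (f i : E → ℝ)) (tsupport (f j : E → ℝ))) →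
          ∀ F : SchwartzMap (Fin n → E) ℂ, IsTensorOf F (fun i => ofRealTest (f i)) →
            Filter.Tendsto (fun k : ℕ => Λ k n σ f) Filter.atTop (nhds (S n σ F)))

/-- **The piece from its stubs (PROVED)**: the named approximant is the wall functional (`rfl`), `1` in degree `0` by fiat, and
`wall = (wall − cover) + (cover − honest) + honest → 0 + 0 + 𝔖ₙ^σ(F)` by the two stubs and `W`'s convergence clause. -/
theorem WallTransparency_of_stubs
    (hCov : ∀ (Nf : ℕ) (sch : QCDScheme Nf) (S : LabelledSchwingerFamily (QCDField Nf) E4), TPkg Nf sch S →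
      ∀ (n : ℕ), n ≠ 0 → ∀ (σ : Fin n → QCDField Nf) (f : Fin n → 𝓢(E4, ℝ)),
        (∀ i, HasCompactSupport (f i : E4 → ℝ)) →
          (∀ i j, i ≠ j → Disjoint (tsupport (f i : E4 → ℝ)) (tsupport (f j : E4 → ℝ))) →
            Tendsto (fun k : ℕ => coverFun Nf sch k n σ f - qcdLatticeSchwinger sch k n σ f) atTop (𝓝 0))
    (hWall : ∀ (Nf : ℕ) (sch : QCDScheme Nf) (S : LabelledSchwingerFamily (QCDField Nf) E4), TPkg Nf sch S →
      ∀ (n : ℕ), n ≠ 0 → ∀ (σ : Fin n → QCDField Nf) (f : Fin n → 𝓢(E4, ℝ)),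
        (∀ i, HasCompactSupport (f i : E4 → ℝ)) →
          (∀ i j, i ≠ j → Disjoint (tsupport (f i : E4 → ℝ)) (tsupport (f j : E4 → ℝ))) →
            Tendsto (fun k : ℕ => wallFun Nf sch k n σ f - coverFun Nf sch k n σ f) atTop (𝓝 0)) :
    WallTransparencyStmt := by
  intro Nf sch S hOS hsch hgap
  have hWpkg : TPkg Nf sch S := ⟨hOS, hsch, hgap⟩
  obtain ⟨-, -, hconv⟩ := hsch
  refine ⟨_, rfl, fun k σ f => if_pos rfl, fun n hn σ f hcs hdisj F hF => ?_⟩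
  -- off-diagonality of the real tensor from the disjoint supports (LANDED YangMills bookkeeping)
  have hoff : IsOffDiagonal F :=
    Summit.QuantumFields.YangMills.Cruxes.DiagonalMirrorRPR.ParityBridgeColdTraces.RpClosure.isOffDiagonal_of_isTensorOf_disjoint
      hF (fun i j hij => Set.disjoint_of_subset
        (Summit.QuantumFields.YangMills.Cruxes.DiagonalMirrorRPR.ParityBridgeColdTraces.RpClosure.tsupport_ofRealTest_subset (f i))
        (Summit.QuantumFields.YangMills.Cruxes.DiagonalMirrorRPR.ParityBridgeColdTraces.RpClosure.tsupport_ofRealTest_subset (f j))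
        (hdisj i j hij))
  -- wall = (wall − cover) + (cover − honest) + honest → 0 + 0 + 𝔖ₙ^σ(F)
  have h := ((hWall Nf sch S hWpkg n hn σ f hcs hdisj).add (hCov Nf sch S hWpkg n hn σ f hcs hdisj)).add
    (hconv n hn σ f F hF hoff)
  simp only [add_zero, zero_add, sub_add_sub_cancel, sub_add_cancel] at h
  exact h

/-- The local verbatim copy IS the route item (definitional). -/
theorem wallTransparencyStmt_iff :
    WallTransparencyStmt ↔ Summit.QuantumFields.QCD.Theses.TransparentRPWall.WallTransparency := Iff.rfl

/-- **`WallTransparency_of`**: the registered stubs imply the ROUTE ITEM BY NAME. -/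
theorem WallTransparency_of :
    (∀ (Nf : ℕ) (sch : QCDScheme Nf) (S : LabelledSchwingerFamily (QCDField Nf) E4), TPkg Nf sch S →
      ∀ (n : ℕ), n ≠ 0 → ∀ (σ : Fin n → QCDField Nf) (f : Fin n → 𝓢(E4, ℝ)),
        (∀ i, HasCompactSupport (f i : E4 → ℝ)) →
          (∀ i j, i ≠ j → Disjoint (tsupport (f i : E4 → ℝ)) (tsupport (f j : E4 → ℝ))) →
            Tendsto (fun k : ℕ => coverFun Nf sch k n σ f - qcdLatticeSchwinger sch k n σ f) atTop (𝓝 0)) →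
    (∀ (Nf : ℕ) (sch : QCDScheme Nf) (S : LabelledSchwingerFamily (QCDField Nf) E4), TPkg Nf sch S →
      ∀ (n : ℕ), n ≠ 0 → ∀ (σ : Fin n → QCDField Nf) (f : Fin n → 𝓢(E4, ℝ)),
        (∀ i, HasCompactSupport (f i : E4 → ℝ)) →
          (∀ i j, i ≠ j → Disjoint (tsupport (f i : E4 → ℝ)) (tsupport (f j : E4 → ℝ))) →
            Tendsto (fun k : ℕ => wallFun Nf sch k n σ f - coverFun Nf sch k n σ f) atTop (𝓝 0)) →
    Summit.QuantumFields.QCD.Theses.TransparentRPWall.WallTransparency :=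
  fun h₁ h₂ => wallTransparencyStmt_iff.1 (WallTransparency_of_stubs h₁ h₂)

/-- **`WallTransparency_proof`**: the route item from the registered stubs (closed modulo the two `stub_*`). -/
theorem WallTransparency_proof : Summit.QuantumFields.QCD.Theses.TransparentRPWall.WallTransparency :=
  WallTransparency_of stub_coverInsensitivityQCD stub_wallInsensitivity

end Summit.QuantumFields.QCD.Cruxes.WallDiagonalRP.WallTransparencyBirth

end
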